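import Summits.CriticalPhenomena.PercolationContinuityZ3.Theorems.PercNearOneGluingNoHeavyQuantPinnedConv
import Summits.CriticalPhenomena.PercolationContinuityZ3.Theorems.PercNearOneGluingNoHeavyQuantLawDecFlows
import Summits.CriticalPhenomena.PercolationContinuityZ3.Theorems.PercNearOneGluingNoHeavyQuantSliceHeavy
import HarnessLib

/-!
# QUANT lane R8, T-DEC: `LawDec.PinnedConvClosed` (second factor merely DEC at every layer) IS FALSE — the gating counterexample of
# census-2 g53, kernel-checked; the corrected statements are `LawDec.PinnedConvGateClosed` / `LawDec.PinnedConvClosedQ` (`…QuantPinnedConv`)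

builds on p205010 (kernel theorem, internal audit signed; external expert review pending)

Refutation file (`--supports stmt-CriticalPhenomena-4575`), QUANT lane LEAD seat prim-quant-lead (gen 24), rung R8 of
`run/shared/lean/prim/quant/LADDER.md` (LEAD-NOTES-G24 N54).  Theorems only, standard axioms, no sorries; every number is an exact rational.

THE WITNESS.  `L = δ₀` (`M₁ = 0`), pinned mass `π = 1/6`, floor `y = 5/12`; second factor `μ = {1 ↦ 36/73, 2 ↦ 1/73, 6 ↦ 36/73}` on `{0..6}`,
floor `x_μ = 1/2` (`(1 − π)·x_μ = 5/12 = y`), mean `254/73`: `μ` is DEC at EVERY layer at floor `1/2` (layers `1..5` by criterion E — at layers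
`2..5` with EQUALITY `½·μ 1 = ½·μ 6` —, layer `0` has no low atom, layers `≥ 6` by Theorem A), i.e. every hypothesis of `PinnedConvClosed` holds;
but `pconv δ₀ (1/6) μ = gate μ (5/6) = {0 ↦ 1/6, 1 ↦ 30/73, 2 ↦ 5/438, 6 ↦ 30/73}` (mean `635/219`) is NOT DEC(2) at floor `5/12`: the lows `0, 1`
carry `1265/438`, the giant `6` absorbs at most `(7/5)·(30/73) = 1260/438` and the mid `2` (compatible with the low `1` only, minimal gate `197/219`,
usage `197/22`) at most `(22/197)·(5/438)`; the price system `α ≡ 5` on the lows, `β 2 = 110/197`, `β ≡ 7` on `h ≥ 3` is feasible for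
`LawDec.dual_le_of_decAtT` and violates it.  This is census-2 g53's smallest counterexample to gate-closure of DEC-at-every-layer
(DEC-CLOSURE-G53 §2.3), read through `gate_lconv_eq_pconv`; the lead's first census of `PinnedConvClosed` missed it because all its second
factors were gate-stable (blobs, blob systems, forest laws).  The structural induction only ever meets gate-stable second factors, which is what
the corrected conjectures ask.

* `LawDec.gcexLaw` and its bookkeeping; `gcexLaw_decAt` (DEC at every layer at floor `1/2`); `gcex_gate_not_decAt` (the gated law is not DEC(2)
  at floor `5/12`); **`LawDec.not_pinnedConvClosed : ¬ PinnedConvClosed`**.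

[this work]; the counterexample law: prim-quant-census-2 g53 (kit j130794).  The gluing rows served [cite: KozmaNitzan2024, Conjecture 3 (p. 15)];
product measure [cite: Grimmett1999, §1.3 p. 10].
-/

noncomputable section

namespace Summit.CriticalPhenomena.PercolationContinuityZ3.Theorems

namespace Quant

namespace LawDec

open Finset

/-! ### The second factor `μ = {1 ↦ 36/73, 2 ↦ 1/73, 6 ↦ 36/73}` -/

/-- census-2 g53's gating counterexample law. [this work] -/
def gcexLaw : ℕ → ℝ := fun h =>
  (if h = 1 then (36 / 73 : ℝ) else 0) + (if h = 2 then (1 / 73 : ℝ) else 0) + (if h = 6 then (36 / 73 : ℝ) else 0)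

/-- `μ ≥ 0`. [this work] -/
theorem gcexLaw_nonneg (h : ℕ) : 0 ≤ gcexLaw h := by
  unfold gcexLaw; split_ifs <;> norm_num

/-- `μ` vanishes above `6`. [this work] -/
theorem gcexLaw_eq_zero (h : ℕ) (hh : 6 < h) : gcexLaw h = 0 := by
  unfold gcexLaw; rw [if_neg (by omega), if_neg (by omega), if_neg (by omega)]; ring

/-- sums of `μ` over any finset. [this work] -/
theorem gcexLaw_sum_finset (s : Finset ℕ) :
    ∑ h ∈ s, gcexLaw h = (if 1 ∈ s then (36 / 73 : ℝ) else 0) + (if 2 ∈ s then (1 / 73 : ℝ) else 0) +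
      (if 6 ∈ s then (36 / 73 : ℝ) else 0) := by
  simp only [gcexLaw, Finset.sum_add_distrib, Finset.sum_ite_eq']

/-- `μ` has mass `1` on `{0..6}`. [this work] -/
theorem gcexLaw_sum : ∑ h ∈ Finset.range (6 + 1), gcexLaw h = 1 := by
  rw [gcexLaw_sum_finset]; norm_num

/-- `μ` has mean `254/73`. [this work] -/
theorem gcexLaw_mean : ∑ h ∈ Finset.range (6 + 1), (h : ℝ) * gcexLaw h = 254 / 73 := by
  simp only [Finset.sum_range_succ, Finset.sum_range_zero, gcexLaw]; norm_num

/-- **`μ` is DEC at every layer at floor `1/2`** (target its mean): layers `≥ 6` by Theorem A (`½·h ≤ 254/73` for `h ≤ 6`), layers `< 6` by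
criterion E (`½·(low mass ≤ 36/73) ≤ ½·(giant mass ≥ 36/73)`; the only low atom is `1`). [this work] -/
theorem gcexLaw_decAt (j' : ℕ) : DECAt (1 / 2) j' 6 gcexLaw := by
  by_cases hj : 6 ≤ j'
  · refine decAt_of_top_le 6 gcexLaw gcexLaw_nonneg gcexLaw_eq_zero gcexLaw_sum (1 / 2) (by norm_num) (fun h hh => ?_) j' hj
    rw [gcexLaw_mean]
    have h6 : h ≤ 6 := by
      by_contra h7; exact absurd (gcexLaw_eq_zero h (by omega)) (ne_of_gt hh)
    have : (h : ℝ) ≤ 6 := by exact_mod_cast h6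
    linarith
  · have hj6 : j' < 6 := not_le.1 hj
    refine decAt_of_giantsAbsorbLows (1 / 2) j' 6 gcexLaw hj6 gcexLaw_nonneg gcexLaw_eq_zero gcexLaw_sum (by norm_num) ?_
    rw [gcexLaw_mean]
    -- low mass ≤ 36/73 (only the atom `1` is low), giant mass ≥ 36/73 (the atom `6` is above every layer `< 6`)
    have hlow : ∑ h ∈ Finset.range (j' + 1), (if 2 * (h : ℝ) < 254 / 73 then gcexLaw h else 0) ≤ 36 / 73 := by
      calc ∑ h ∈ Finset.range (j' + 1), (if 2 * (h : ℝ) < 254 / 73 then gcexLaw h else 0)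
          ≤ ∑ h ∈ Finset.range (j' + 1), (if h = 1 then (36 / 73 : ℝ) else 0) := by
            refine Finset.sum_le_sum fun h _ => ?_
            by_cases h1 : h = 1
            · subst h1; norm_num [gcexLaw]
            · rw [if_neg h1]
              split_ifs with hlt
              · have h2 : h < 2 := by
                  by_contra hge
                  have : (2 : ℝ) ≤ h := by exact_mod_cast (not_lt.1 hge)
                  linarith
                have h0 : h = 0 := by omega
                subst h0; simp [gcexLaw]
              · exact le_rfl
        _ ≤ 36 / 73 := by rw [Finset.sum_ite_eq']; split_ifs <;> norm_num
    have hG : 36 / 73 ≤ ∑ h ∈ Finset.Ico (j' + 1) (6 + 1), gcexLaw h := by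
      have h6mem : 6 ∈ Finset.Ico (j' + 1) (6 + 1) := Finset.mem_Ico.2 ⟨by omega, by norm_num⟩
      rw [gcexLaw_sum_finset, if_pos h6mem]
      have a : 0 ≤ (if 1 ∈ Finset.Ico (j' + 1) (6 + 1) then (36 / 73 : ℝ) else 0) := by split_ifs <;> norm_num
      have b : 0 ≤ (if 2 ∈ Finset.Ico (j' + 1) (6 + 1) then (1 / 73 : ℝ) else 0) := by split_ifs <;> norm_num
      linarith
    linarith

/-! ### The gated law `gate μ (5/6)` is not DEC(2) at floor `5/12` -/

/-- `pconv δ₀ (1/6) μ` is the gated law `{0 ↦ 1/6, 1 ↦ 30/73, 2 ↦ 5/438, 6 ↦ 30/73}`. [this work] -/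
theorem gcex_pconv_eq (h : ℕ) :
    pconv 0 6 (fun k => if k = 0 then (1 : ℝ) else 0) (1 / 6) gcexLaw h =
      (if h = 0 then (1 / 6 : ℝ) else 0) + (if h = 1 then (30 / 73 : ℝ) else 0) + (if h = 2 then (5 / 438 : ℝ) else 0) +
        (if h = 6 then (30 / 73 : ℝ) else 0) := by
  simp only [pconv, lconv, Finset.sum_range_succ, Finset.sum_range_zero, gcexLaw, zero_add]
  rcases Nat.lt_or_ge h 7 with hlt | hge
  · interval_cases h <;> norm_num
  · rw [if_neg (by omega), if_neg (by omega), if_neg (by omega), if_neg (by omega), if_neg (by omega), if_neg (by omega),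
      if_neg (by omega), if_neg (by omega)]
    norm_num
    rw [if_neg (by omega), if_neg (by omega), if_neg (by omega)]
    norm_num

/-- mean of the gated law: `635/219`. [this work] -/
theorem gcex_pconv_mean :
    ∑ h ∈ Finset.range (0 + 6 + 1), (h : ℝ) * pconv 0 6 (fun k => if k = 0 then (1 : ℝ) else 0) (1 / 6) gcexLaw h = 635 / 219 := by
  simp only [gcex_pconv_eq, Finset.sum_range_succ, Finset.sum_range_zero]; norm_num

/-- prices of the violating certificate: `α ≡ 5` on the lows `0, 1`. [this work] -/
def gcexα : ℕ → ℝ := fun l => if l ≤ 1 then 5 else 0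

/-- prices of the violating certificate: `β 2 = 110/197` (the mid), `β ≡ 7` on `h ≥ 3`. [this work] -/
def gcexβ : ℕ → ℝ := fun h => if h = 2 then 110 / 197 else if 3 ≤ h then 7 else 0

/-- **the gated law is NOT DEC(2) at floor `5/12` and target `635/219` (its mean)**: weak duality `dual_le_of_decAtT` with the prices
`(gcexα, gcexβ)` (feasible: giants `5 = (5/7)·7`, the mid pair `(1,2)` has usage `197/22` and `5 = (197/22)·(110/197)`) would give
`1265/438 ≤ 550/86286 + 1260/438`, false. [this work] -/
theorem gcex_gate_not_decAtT :
    ¬ DECAtT (5 / 12) (635 / 219) 2 (0 + 6) (pconv 0 6 (fun k => if k = 0 then (1 : ℝ) else 0) (1 / 6) gcexLaw) := by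
  intro hdec
  have key := dual_le_of_decAtT (5 / 12) (635 / 219) 2 (0 + 6) _ (by norm_num) (by norm_num) hdec
    gcexα gcexβ (fun h => by unfold gcexβ; split_ifs <;> norm_num) ?_
  · revert key
    simp only [Finset.sum_range_succ, Finset.sum_range_zero, gcex_pconv_eq, gcexα, gcexβ]
    norm_num
  · intro l h hl hlT hh hcomp
    have hl1 : l ≤ 1 := by
      by_contra hl2
      have : (2 : ℝ) ≤ l := by exact_mod_cast (by omega : 2 ≤ l)
      linarith
    by_cases h3 : 3 ≤ h
    · -- a giant: usage `x/(1−x) = 5/7`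
      have hu : usage (5 / 12) (635 / 219) 2 l h = 5 / 7 := by
        simp only [usage, gateOf, if_pos h3]; norm_num
      rw [hu]
      simp only [gcexα, gcexβ, if_pos hl1, if_neg (show ¬ h = 2 by omega), if_pos h3]
      norm_num
    · -- a mid: the only compatible pair is `(1, 2)`
      have hc : (635 / 219 : ℝ) < l + h := hcomp.resolve_left h3
      have h3' : 3 ≤ l + h := by
        by_contra hlt
        have : ((l + h : ℕ) : ℝ) ≤ 2 := by exact_mod_cast (by omega : l + h ≤ 2)
        push_cast at this
        linarith
      obtain ⟨rfl, rfl⟩ : l = 1 ∧ h = 2 := by omega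
      simp only [gcexα, gcexβ, usage, gateOf, pairGate]
      norm_num [max_def]

/-- at its own mean: the gated law is not `LawDec.DECAt` at layer `2`, floor `5/12`. [this work] -/
theorem gcex_gate_not_decAt :
    ¬ DECAt (5 / 12) 2 (0 + 6) (pconv 0 6 (fun k => if k = 0 then (1 : ℝ) else 0) (1 / 6) gcexLaw) := by
  rw [decAt_iff_decAtT, gcex_pconv_mean]
  exact gcex_gate_not_decAtT

/-! ### The refutation -/

/-- **`LawDec.PinnedConvClosed` (the form with a merely DEC-at-every-layer second factor) IS FALSE.**  Witness: `y = 5/12`, `M₁ = 0`, `M₂ = 6`,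
`L = δ₀` (DEC at every layer: `decAt_point`), `π = 1/6 ≤ L 0 = 1`, `π ≤ 7/12 = 1 − y`, `μ = gcexLaw` at floor `x_μ = 1/2 < 1` with
`y = (1 − π)·x_μ`, DEC at every layer (`gcexLaw_decAt`); the conclusion fails at layer `2` (`gcex_gate_not_decAt`).  The corrected conjectures
`PinnedConvGateClosed` / `PinnedConvClosedQ` (gate-stable second factor) are not touched. [this work] -/
theorem not_pinnedConvClosed : ¬ PinnedConvClosed := by
  intro hP
  refine gcex_gate_not_decAt (hP (5 / 12) 0 6 (fun k => if k = 0 then (1 : ℝ) else 0) gcexLaw (1 / 6) (1 / 2)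
    (by norm_num) (by norm_num) (fun h => by split_ifs <;> norm_num) (fun h hh => if_neg (by omega)) (by simp)
    gcexLaw_nonneg gcexLaw_eq_zero gcexLaw_sum (by norm_num) (by simp; norm_num) (by norm_num) (by norm_num) (by norm_num)
    (fun j' => decAt_point (5 / 12) j' 0) gcexLaw_decAt 2)

/-! ### APPENDED (lead g24, same session): the corrected-as-typed forms `PinnedConvGateClosed` / `PinnedConvClosedQ` are FALSE too

THE SECOND WITNESS (postcont-1 g82, `postcont/prim-postcont-1-g82/calc/pinned82c.py`, C3; re-derived here).  `y = 2/3`, `L = {0 ↦ 11/40, 1 ↦ 11/80, 2 ↦ 47/80}`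
(`M₁ = 2`, mean `21/16 < 4/3 = y·M₁`: NOT top-affordable; DEC at EVERY layer at floor `2/3` — layers `0, 1` by criterion E, layers `≥ 2` through the
LIGHT credit pair `{0, 2; 191/288}` (`κ = (g − y²)/(1−y) = 21/32`, credit `2κ = 21/16` = mean exactly) + sure points `1`, `2`), `π = 11/40 = L 0`
(`≤ 1 − y`), `x_μ = 80/87` (`(1 − π)·x_μ = 2/3 = y`), `μ = {0 ↦ 2/27, 1 ↦ 25/27} = gate δ₁ (25/27)` (`M₂ = 1`), which is GATE-STABLE at `x_μ`: every
`gate μ q′ = gate δ₁ (25q′/27)` is DEC at every layer at floor `q′·80/87 ≤ 25q′/27` (`sdec_gate_point` + `sdec_mono` + `decAt_gate_of_sdec`).  Every hypothesis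
of `PinnedConvGateClosed` holds, but `pconv L π μ = {0 ↦ 11/40, 1 ↦ 11/1080, 2 ↦ 41/240, 3 ↦ 235/432}` (mean `857/432`) is NOT DEC(2) at floor `2/3`: its
only low atom `0` can be shipped to the giant `3` (usage `2`) or to the mid `2` (`857/432 < 2`, minimal gate `857/864`, usage `857/7`) — the mid `1`
is incompatible (`1 < 857/432`) —, and the prices `α 0 = 2`, `β 2 = 14/857`, `β ≡ 1` on `h ≥ 3` violate weak duality (`11/20 > 14·41/(857·240) + 235/432`).
So the top-affordability (or gate-stability) of the PINNED factor, which the structural induction has (`L = gate μ₁ q` with `x·M₁ ≤ mean μ₁`), cannot be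
dropped; postcont-1 g82's exact census with it: 0 / 4 066.  **`not_pinnedConvGateClosed`**, **`not_pinnedConvClosedQ`** (via `pinnedConvGateClosed_of_Q`).
Credit: the witness is prim-postcont-1 g82's (C3, `postcont/prim-postcont-1-g82/calc/pinned82c.py`), re-derived and kernel-checked here. -/

/-! ### The second witness (postcont-1 g82, C3): `L = {0 ↦ 11/40, 1 ↦ 11/80, 2 ↦ 47/80}`, `π = L 0`, `μ = gate δ₁ (25/27)` -/

/-- the two-point law `{lo, hi; g}` (as in `…QuantLawDEC`) -/
local notation3 "TP[" lo ", " hi ", " g ", " h "]" =>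
  (g : ℝ) * (if (h : ℕ) = (hi : ℕ) then (1 : ℝ) else 0) + (1 - (g : ℝ)) * (if (h : ℕ) = (lo : ℕ) then (1 : ℝ) else 0)

/-- postcont-1 g82's pinned factor `L`. [this work] -/
def c3L : ℕ → ℝ := fun h =>
  (if h = 0 then (11 / 40 : ℝ) else 0) + (if h = 1 then (11 / 80 : ℝ) else 0) + (if h = 2 then (47 / 80 : ℝ) else 0)

/-- postcont-1 g82's second factor `μ = gate δ₁ (25/27) = {0 ↦ 2/27, 1 ↦ 25/27}`, written as a gated sure relay. [this work] -/
def c3μ : ℕ → ℝ := gate (fun h => if h = 1 then (1 : ℝ) else 0) (25 / 27)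

/-- `L ≥ 0`. [this work] -/
theorem c3L_nonneg (h : ℕ) : 0 ≤ c3L h := by unfold c3L; split_ifs <;> norm_num

/-- `L` vanishes above `2`. [this work] -/
theorem c3L_eq_zero (h : ℕ) (hh : 2 < h) : c3L h = 0 := by
  unfold c3L; rw [if_neg (by omega), if_neg (by omega), if_neg (by omega)]; ring

/-- sums of `L` over any finset. [this work] -/
theorem c3L_sum_finset (s : Finset ℕ) :
    ∑ h ∈ s, c3L h = (if 0 ∈ s then (11 / 40 : ℝ) else 0) + (if 1 ∈ s then (11 / 80 : ℝ) else 0) + (if 2 ∈ s then (47 / 80 : ℝ) else 0) := by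
  simp only [c3L, Finset.sum_add_distrib, Finset.sum_ite_eq']

/-- `L` has mass `1` on `{0..2}`. [this work] -/
theorem c3L_sum : ∑ h ∈ Finset.range (2 + 1), c3L h = 1 := by rw [c3L_sum_finset]; norm_num

/-- `L` has mean `21/16`. [this work] -/
theorem c3L_mean : ∑ h ∈ Finset.range (2 + 1), (h : ℝ) * c3L h = 21 / 16 := by
  simp only [Finset.sum_range_succ, Finset.sum_range_zero, c3L]; norm_num

/-- case split on an atom of `L`. [folklore] -/
theorem c3L_cases (h : ℕ) : h = 0 ∨ h = 1 ∨ h = 2 ∨ (h ≠ 0 ∧ h ≠ 1 ∧ h ≠ 2) := by omega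

/-- **`L` is DEC at every layer `j′ ≥ 2` at floor `2/3`, target `21/16`**: the LIGHT credit pair `{0, 2; 191/288}` (credit `2·(191/288 − 4/9)/(1/3) = 21/16`)
with weight `396/485`, sure points `1` (weight `11/80`), `2` (weight `357/7760`). [this work] -/
theorem c3L_decAtT_ge_two (j' : ℕ) (hj : 2 ≤ j') : DECAtT (2 / 3) (21 / 16) j' 2 c3L := by
  refine decAtT_finite_mixture (ι := Fin 3) (2 / 3) (21 / 16) j' 2 c3L
    ![396 / 485, 11 / 80, 357 / 7760]
    ![fun h => TP[0, 2, (191 / 288 : ℝ), h], fun h => TP[1, 1, (0 : ℝ), h], fun h => TP[2, 2, (0 : ℝ), h]]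
    ?_ ?_ ?_ ?_
  · intro i; fin_cases i <;> norm_num
  · simp only [Fin.sum_univ_three, Matrix.cons_val_zero, Matrix.cons_val_one, Matrix.cons_val]; norm_num
  · intro h
    simp only [Fin.sum_univ_three, Matrix.cons_val_zero, Matrix.cons_val_one, Matrix.cons_val]
    rcases c3L_cases h with rfl | rfl | rfl | ⟨h0, h1, h2⟩
    · norm_num [c3L]
    · norm_num [c3L]
    · norm_num [c3L]
    · simp [c3L, h0, h1, h2]
  · intro i _
    fin_cases i
    · refine decAtT_single (2 / 3) (21 / 16) j' 2 0 2 (191 / 288) (by norm_num) (by norm_num) le_rfl ?_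
      refine Or.inr (Or.inr ⟨by norm_num, hj, ?_⟩)
      rw [if_neg (by norm_num)]
      norm_num
    · exact decAtT_single (2 / 3) (21 / 16) j' 2 1 1 0 (by norm_num) le_rfl (by norm_num) (Or.inl ⟨rfl, Or.inl (by norm_num)⟩)
    · exact decAtT_single (2 / 3) (21 / 16) j' 2 2 2 0 (by norm_num) le_rfl le_rfl (Or.inl ⟨rfl, Or.inl (by norm_num)⟩)

/-- **`L` is DEC at every layer at floor `2/3`** (its own mean `21/16`): layers `0`, `1` by criterion E (`(2/3)·(11/40) ≤ (1/3)·(47/80)`), layers `≥ 2`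
by `c3L_decAtT_ge_two`. [this work] -/
theorem c3L_decAt (j' : ℕ) : DECAt (2 / 3) j' 2 c3L := by
  by_cases hj : 2 ≤ j'
  · rw [decAt_iff_decAtT, c3L_mean]; exact c3L_decAtT_ge_two j' hj
  · have hj2 : j' < 2 := not_le.1 hj
    refine decAt_of_giantsAbsorbLows (2 / 3) j' 2 c3L hj2 c3L_nonneg c3L_eq_zero c3L_sum (by norm_num) ?_
    rw [c3L_mean]
    have hlow : ∑ h ∈ Finset.range (j' + 1), (if 2 * (h : ℝ) < 21 / 16 then c3L h else 0) ≤ 11 / 40 := by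
      calc ∑ h ∈ Finset.range (j' + 1), (if 2 * (h : ℝ) < 21 / 16 then c3L h else 0)
          ≤ ∑ h ∈ Finset.range (j' + 1), (if h = 0 then (11 / 40 : ℝ) else 0) := by
            refine Finset.sum_le_sum fun h _ => ?_
            by_cases h0 : h = 0
            · subst h0; norm_num [c3L]
            · rw [if_neg h0]
              split_ifs with hlt
              · have : (1 : ℝ) ≤ h := by exact_mod_cast Nat.one_le_iff_ne_zero.2 h0
                linarith
              · exact le_rfl
        _ ≤ 11 / 40 := by rw [Finset.sum_ite_eq']; split_ifs <;> norm_num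
    have hG : 47 / 80 ≤ ∑ h ∈ Finset.Ico (j' + 1) (2 + 1), c3L h := by
      have h2mem : 2 ∈ Finset.Ico (j' + 1) (2 + 1) := Finset.mem_Ico.2 ⟨by omega, by norm_num⟩
      rw [c3L_sum_finset, if_pos h2mem]
      have a : 0 ≤ (if 0 ∈ Finset.Ico (j' + 1) (2 + 1) then (11 / 40 : ℝ) else 0) := by split_ifs <;> norm_num
      have b : 0 ≤ (if 1 ∈ Finset.Ico (j' + 1) (2 + 1) then (11 / 80 : ℝ) else 0) := by split_ifs <;> norm_num
      linarith
    linarith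

/-- `μ ≥ 0`. [this work] -/
theorem c3μ_nonneg (h : ℕ) : 0 ≤ c3μ h := by
  simp only [c3μ, gate]; split_ifs <;> norm_num

/-- `μ` vanishes above `1`. [this work] -/
theorem c3μ_eq_zero (h : ℕ) (hh : 1 < h) : c3μ h = 0 := by
  simp only [c3μ, gate]; rw [if_neg (by omega), if_neg (by omega)]; norm_num

/-- `μ` has mass `1` on `{0..1}`. [this work] -/
theorem c3μ_sum : ∑ h ∈ Finset.range (1 + 1), c3μ h = 1 := by
  simp only [Finset.sum_range_succ, Finset.sum_range_zero, c3μ, gate]; norm_num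

/-- `μ` has mean `25/27`. [this work] -/
theorem c3μ_mean : ∑ h ∈ Finset.range (1 + 1), (h : ℝ) * c3μ h = 25 / 27 := by
  simp only [Finset.sum_range_succ, Finset.sum_range_zero, c3μ, gate]; norm_num

/-- **`μ` is gate-stable at floor `80/87`**: every `gate μ q′` (`0 < q′ ≤ 1`) is DEC at every layer at floor `q′·80/87` (a gated sure relay is SDEC at the
floor of its gate, `25/27 ≥ 80/87`). [this work] -/
theorem c3μ_gate_decAt (q' : ℝ) (hq0 : 0 < q') (hq1 : q' ≤ 1) (j' : ℕ) : DECAt (q' * (80 / 87)) j' 1 (gate c3μ q') := by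
  have hs : SDEC (80 / 87) 1 c3μ :=
    sdec_mono (sdec_gate_point (25 / 27) (by norm_num) (by norm_num) 1) (by norm_num) (by norm_num)
  exact decAt_gate_of_sdec hs (by norm_num) (by norm_num) c3μ_nonneg c3μ_eq_zero c3μ_sum (by rw [c3μ_mean]; norm_num) q' hq0 hq1 j'

/-- the pinned convolution of the witness: `{0 ↦ 11/40, 1 ↦ 11/1080, 2 ↦ 41/240, 3 ↦ 235/432}`. [this work] -/
theorem c3_pconv_eq (h : ℕ) :
    pconv 2 1 c3L (11 / 40) c3μ h =
      (if h = 0 then (11 / 40 : ℝ) else 0) + (if h = 1 then (11 / 1080 : ℝ) else 0) + (if h = 2 then (41 / 240 : ℝ) else 0) +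
        (if h = 3 then (235 / 432 : ℝ) else 0) := by
  simp only [pconv, lconv, Finset.sum_range_succ, Finset.sum_range_zero, c3L, c3μ, gate, zero_add]
  rcases Nat.lt_or_ge h 4 with hlt | hge
  · interval_cases h <;> norm_num
  · rw [if_neg (by omega), if_neg (by omega), if_neg (by omega), if_neg (by omega), if_neg (by omega), if_neg (by omega),
      if_neg (by omega), if_neg (by omega), if_neg (by omega), if_neg (by omega)]
    norm_num

/-- mean of the pinned convolution: `857/432`. [this work] -/
theorem c3_pconv_mean : ∑ h ∈ Finset.range (2 + 1 + 1), (h : ℝ) * pconv 2 1 c3L (11 / 40) c3μ h = 857 / 432 := by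
  simp only [c3_pconv_eq, Finset.sum_range_succ, Finset.sum_range_zero]; norm_num

/-- prices: `α 0 = 2` (the only low atom). [this work] -/
def c3α : ℕ → ℝ := fun l => if l = 0 then 2 else 0

/-- prices: `β 2 = 14/857` (the compatible mid), `β ≡ 1` on `h ≥ 3`. [this work] -/
def c3β : ℕ → ℝ := fun h => if h = 2 then 14 / 857 else if 3 ≤ h then 1 else 0

/-- **the pinned convolution is NOT DEC(2) at floor `2/3`, target `857/432`** (weak duality with `(c3α, c3β)`: giants usage `2`, the mid pair `(0, 2)`
usage `857/7`; `11/20 ≤ 14·41/(857·240) + 235/432` is false). [this work] -/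
theorem c3_pconv_not_decAtT : ¬ DECAtT (2 / 3) (857 / 432) 2 (2 + 1) (pconv 2 1 c3L (11 / 40) c3μ) := by
  intro hdec
  have key := dual_le_of_decAtT (2 / 3) (857 / 432) 2 (2 + 1) _ (by norm_num) (by norm_num) hdec
    c3α c3β (fun h => by unfold c3β; split_ifs <;> norm_num) ?_
  · revert key
    simp only [Finset.sum_range_succ, Finset.sum_range_zero, c3_pconv_eq, c3α, c3β]
    norm_num
  · intro l h hl hlT hh hcomp
    have hl0 : l = 0 := by
      by_contra hl1
      have : (1 : ℝ) ≤ l := by exact_mod_cast Nat.one_le_iff_ne_zero.2 hl1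
      linarith
    subst hl0
    by_cases h3 : 3 ≤ h
    · have hu : usage (2 / 3) (857 / 432) 2 0 h = 2 := by
        simp only [usage, gateOf, if_pos h3]; norm_num
      rw [hu]
      simp only [c3α, c3β, if_neg (show ¬ h = 2 by omega), if_pos h3]
      norm_num
    · have hc : (857 / 432 : ℝ) < (0 : ℕ) + h := hcomp.resolve_left h3
      have h2 : h = 2 := by
        have : 2 ≤ h := by
          by_contra hlt
          have : ((h : ℕ) : ℝ) ≤ 1 := by exact_mod_cast (by omega : h ≤ 1)
          push_cast at hc; linarith
        omega
      subst h2
      simp only [c3α, c3β, usage, gateOf, pairGate]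
      norm_num [max_def]

/-- at its own mean: the pinned convolution is not `LawDec.DECAt` at layer `2`, floor `2/3`. [this work] -/
theorem c3_pconv_not_decAt : ¬ DECAt (2 / 3) 2 (2 + 1) (pconv 2 1 c3L (11 / 40) c3μ) := by
  rw [decAt_iff_decAtT, c3_pconv_mean]; exact c3_pconv_not_decAtT

/-- **`LawDec.PinnedConvGateClosed` (as typed in `…QuantPinnedConv`, without top-affordability of the pinned factor) IS FALSE** — witness C3 of
postcont-1 g82. [this work] -/
theorem not_pinnedConvGateClosed : ¬ PinnedConvGateClosed := by
  intro hP
  refine c3_pconv_not_decAt (hP (2 / 3) 2 1 c3L c3μ (11 / 40) (80 / 87) (by norm_num) (by norm_num) c3L_nonneg c3L_eq_zero c3L_sum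
    c3μ_nonneg c3μ_eq_zero c3μ_sum (by norm_num) (by norm_num [c3L]) (by norm_num) (by norm_num) (by norm_num) c3L_decAt c3μ_gate_decAt 2)

/-- **`LawDec.PinnedConvClosedQ` (as typed) IS FALSE** (it implies `PinnedConvGateClosed`, `pinnedConvGateClosed_of_Q`). [this work] -/
theorem not_pinnedConvClosedQ : ¬ PinnedConvClosedQ := fun hQ => not_pinnedConvGateClosed (pinnedConvGateClosed_of_Q hQ)


end LawDec

end Quant

end Summit.CriticalPhenomena.PercolationContinuityZ3.Theorems

end
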